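import Summits.QuantumFields.BalabanUV.Beta.GAN24.OneStepLoopContraction

/-!
# `BalabanUV.Beta.GAN24.OneStepLoopContractionMovingLegs` — binder row G-an2-4 ∕ (CONV-C), routes C-R6° («VALUES») × R7 («TWO CURRENCIES»), PART 197:
# THE ONE-LOOP CONTRACTION WITH LEVEL-DEPENDENT («MOVING») LEGS `Γ_{1,k}(Y_k ⊗ₖ Y_k)Γ_{2,k}ᴴ` — (UD)+(SR), THE `ℤ^d` END FOR ANY INPUT TRIPLE, AND FOR THE LOOP COVARIANCE
# `Y = c⁻¹𝒢c⁻¹`.  Census V196 reads the loop contraction `(i,j) ↦ tr(Y_kΣ_{i,k}Y_kΣ_{j,k})` with legs the INSERTION WORDS `Σ_{i,k} = c_k⁻¹X_{i,k}c_k⁻¹`, which DEPEND ON THE LEVEL `k`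
# and converge at the tower's ratio; PARTs 131 ∕ 132 ∕ 153 ∕ 196 dress with level-INDEPENDENT legs.  This file supplies the three-term telescoping
# `Γ′K′Γ′ᴴ − ΓKΓᴴ = (Γ′−Γ)K′Γ′ᴴ + Γ(K′−K)Γ′ᴴ + ΓK(Γ′−Γ)ᴴ` (PART 131's `entryDecay_vertexDress` three times), hence (SR) of the dressed diagram with constant
# `(γ₁′γ₂ + γ₁γ₂′)·C + γ₁γ₂·C′` when the legs carry the envelope `γᵢe^{−κD}` at every level and the step envelope `γᵢ′θ^k e^{−κD}`; then PART 196's §2 ∕ §3b verbatim with moving legs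
# (unit b2b-balaban-gan24-p3, gen 61; v1)

NOT IN PRINT; OUR PROOF ([folklore] bookkeeping BY NAME over PART 131 `DiagramDecayVertices.entryDecay_vertexDress`, PART 130 `DiagramDecayAlgebra` (`entryDecay_kronecker`,
`twoLevelDecayRate_kronecker`, `twoLevelDecayRate_const_nonneg`, `twoLevelDecayRate_of_le_rate`), PART 128 `entryDecay_of_le_rate`, PART 132 `DiagramDecayTorus` (`sum_exp_pairDistK_le`,
`distK_legs_laws`), PART 140 `DiagramVolumeLimit.conv_of_decay_of_tendsto`, PART 150 `DiagramVolumeLimitLegs.tendsto_legs_pair`, PART 153 `exp_distK_le_exp_window_pair'`, PART 143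
`norm_le_of_entryDecay`, PART 195 `exists_loopCov_inputs`; [Balaban1987RG1] (1.20)–(1.22) p. 264 LOCATE the one-loop shape and the `T ↗ ℤ^d` limit; nothing printed is a hypothesis).
HONEST FRAMING (cell contract, verbatim): «discharging `BetaPertH` makes Bałaban's UV stability UNCONDITIONAL — a real constructive-QFT result; it is NOT the
continuum limit and NOT the Clay problem.»  HONEST DEPENDENCY (verbatim): «continuum YM on T⁴ ⇐ BetaPertH ∧ nine spine estimates (0/9 proved); BetaPertH ⇐
(D1) ∧ (D4) ∧ CAP+tail; G-an2-4 gates asym, D1 and NE2/3/4.»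

WHAT THIS FILE PROVES (0 sorry, 0 `def`):
* §1 (GENERIC, any index types, distances `dist, dp, D` with PART 131's laws) **`twoLevelDecayRate_vertexDress_moving`** — (SR) of `k ↦ Γ_{1,k}K_kΓ_{2,k}ᴴ` with constant
  `(γ₁′Bγ₂ + γ₁B′γ₂ + γ₁Bγ₂′)·S₁S₂` at rate `κ∕4`, from (UD) `B` + (SR) `B′` of `K` and the legs' level ∕ step envelopes.
* §2 (torus `idx L M 0`, `d ≥ 2`) **`decay_oneLoop_of_inputs_moving`** — (UD) `γ₁γ₂C` + (SR) `(γ₁′γ₂ + γ₁γ₂′)C + γ₁γ₂C′` of `Γ_{1,k}(Y_k ⊗ₖ Y_k)Γ_{2,k}ᴴ` for ANY tower with the triple's decay clauses.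
* §3 (cubic `side t → ∞`) **`conv_oneLoop_of_inputs_moving`** — the `ℤ^d` END (`IsInfiniteVolumeLimit`, `UniformDecay`, `StepRate θ`, `KernelInputs`, second moments) of
  `Γ_{1,t,k}(Y_{t,k} ⊗ₖ Y_{t,k})Γ_{2,t,k}ᴴ` for ANY volume-indexed INPUT triple (`θ < 1`) and moving legs with level ∕ step envelopes and EL₃ at every level.
* §4 **`conv_oneLoop_loopCov_moving_of_rate`** — §3 for PART 195's loop covariance `Y = c⁻¹𝒢c⁻¹` of the gauge-fixed one-loop step (dimension `d + 1 ≥ 2`, `L ≥ 2`, every `Lb`, `a, a′`,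
  every cubic coarse volume sequence), legs at ANY prescribed rate `κ_Γ > 0` with step ratio `√(L⁻¹)`; conclusion at rate `min κ₀ κ_Γ`.  NO residual hypothesis beyond the legs.
WHAT IT IS NOT: the legs themselves (the insertion words' TWO-POINT decay about the insertion bond, their step envelope and EL₃ — row an1's dictionary; PART 159 gives (UD)+(SR) of
`X_{w,k}` in `distK(q,r)`, not about the root); the tadpoles; first-order MODEL framing unchanged.  SUPPLIER work; NEVER «G-an2-4 closed»; NOT (CONV-C), NOT D1, NOT `BetaPertH`,
NOT continuum, NOT Clay.  Records: `HOME/b2b-balaban-gan24-p3/gen61/README.md`.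
-/

noncomputable section

open scoped BigOperators ComplexConjugate Matrix Matrix.Norms.L2Operator Kronecker
open Filter Topology Finset Matrix

namespace Summit.QuantumFields.BalabanUV.Beta.GAN24.OneStepLoopContractionMovingLegs

open Literature.MathematicalPhysics.QuantumFieldTheory.Balaban1983to89
open Literature.MathematicalPhysics.QuantumFieldTheory.Balaban1983to89.B5Prop11Plancherel (Tor fine)
open Literature.MathematicalPhysics.QuantumFieldTheory.Balaban1983to89.B5RealFields (reM)
open Literature.MathematicalPhysics.QuantumFieldTheory.Balaban1983to89.B5G183RateUnitTower (lev)
open Literature.MathematicalPhysics.QuantumFieldTheory.Balaban1983to89.B12Sec2to5 (l1 betaPrime510)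
open Literature.MathematicalPhysics.QuantumFieldTheory.Balaban1983to89.Beta (IsInfiniteVolumeLimit windowMap)
open Literature.MathematicalPhysics.QuantumFieldTheory.Balaban1983to89.Beta.FreeLegDictionary (cubic)
open Literature.MathematicalPhysics.QuantumFieldTheory.Balaban1983to89.Beta.VectorTails (castT)
open Literature.MathematicalPhysics.QuantumFieldTheory.Balaban1983to89.Beta.LimitRate (StepRate limKernelOf KernelInputs)
open Literature.MathematicalPhysics.QuantumFieldTheory.Balaban1983to89.Beta.CompositionSingular (flucCov)
open Literature.MathematicalPhysics.QuantumFieldTheory.Balaban1983to89.Beta.BlockEffectiveAction (DelK)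
open Summit.QuantumFields.BalabanUV.T4Continuum.BalabanLineAverage (QB)
open Summit.QuantumFields.BalabanUV.T4Continuum.BalabanAveragedTowerModes (par rem)
open Summit.QuantumFields.BalabanUV.T4Continuum.BalabanAveragedTowerUnit (idx unitCovB one_le_lev')
open Summit.QuantumFields.BalabanUV.T4Continuum.BalabanAveragedCoerciveTower (unitIdx)
open Summit.QuantumFields.BalabanUV.T4Continuum.CTKingTowerWeights (distK)
open Summit.QuantumFields.BalabanUV.T4Continuum.DecayRateInterpolation (EntryDecay TwoLevelDecayRate)
open Summit.QuantumFields.BalabanUV.Beta.GAN24.DiagramDecayAlgebra (entryDecay_kronecker twoLevelDecayRate_kronecker twoLevelDecayRate_const_nonneg twoLevelDecayRate_of_le_rate)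
open Summit.QuantumFields.BalabanUV.Beta.GAN24.DiagramDecayVertices (entryDecay_vertexDress)
open Summit.QuantumFields.BalabanUV.Beta.GAN24.UnitLatticeDecayAlgebra (distK_nonneg)
open Summit.QuantumFields.BalabanUV.Beta.GAN24.EffectiveFormDecay (entryDecay_of_le_rate)
open Summit.QuantumFields.BalabanUV.Beta.GAN24.DiagramDecayTorus (sum_exp_pairDistK_le distK_legs_laws)
open Summit.QuantumFields.BalabanUV.Beta.GAN24.DiagramVolumeLimit (conv_of_decay_of_tendsto)
open Summit.QuantumFields.BalabanUV.Beta.GAN24.DiagramVolumeLimitSandwich (norm_le_of_entryDecay)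
open Summit.QuantumFields.BalabanUV.Beta.GAN24.DiagramVolumeLimitLegs (tendsto_legs_pair)
open Summit.QuantumFields.BalabanUV.Beta.GAN24.DiagramVolumeLimitOneLoop (exp_distK_le_exp_window_pair')
open Summit.QuantumFields.BalabanUV.Beta.GAN24.OneStepLoopCovarianceInputTriple (exists_loopCov_inputs)

/-! ## §1 The three-term telescoping: (SR) of a dressed diagram with moving legs -/

section Vertex

variable {n p : Type*} [Fintype p] {dist : n → n → ℝ} {dp : p → p → ℝ} {D : n → p → ℝ}

/-- **`twoLevelDecayRate_vertexDress_moving` — (SR) OF `k ↦ Γ_{1,k}K_kΓ_{2,k}ᴴ` WITH LEVEL-DEPENDENT LEGS** (PART 131's distance laws; `κ, γᵢ, γᵢ′, B, B′, θ ≥ 0`): if every leg has the envelope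
`‖Γ_{i,k}(x,u)‖ ≤ γᵢe^{−κD(x,u)}` at every level and the step envelope `‖(Γ_{i,k+1} − Γ_{i,k})(x,u)‖ ≤ γᵢ′θ^k e^{−κD(x,u)}`, and `K` has (UD) `B` and (SR) `(B′, θ)` at rate `κ` in `dp`, then
`TwoLevelDecayRate dist (k ↦ Γ_{1,k}K_kΓ_{2,k}ᴴ) ((γ₁′Bγ₂ + γ₁B′γ₂ + γ₁Bγ₂′)·S₁S₂) (κ∕4) θ` — by `Γ′K′Γ′ᴴ − ΓKΓᴴ = (Γ′−Γ)K′Γ′ᴴ + Γ(K′−K)Γ′ᴴ + ΓK(Γ′−Γ)ᴴ` and `entryDecay_vertexDress` thrice. [folklore] -/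
theorem twoLevelDecayRate_vertexDress_moving (hDp : ∀ x u v, D x v ≤ D x u + dp u v) (hDD : ∀ x y u, dist x y ≤ D x u + D y u)
    (hdp0 : ∀ u v, 0 ≤ dp u v) (hD0 : ∀ x u, 0 ≤ D x u) {κ S₁ S₂ γ₁ γ₂ γ₁' γ₂' B B' θ : ℝ} (hκ : 0 ≤ κ) (hγ₁ : 0 ≤ γ₁) (hγ₂ : 0 ≤ γ₂) (hγ₁' : 0 ≤ γ₁') (hγ₂' : 0 ≤ γ₂')
    (hB : 0 ≤ B) (hB' : 0 ≤ B') (hθ : 0 ≤ θ)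
    (hS₁ : ∀ x, ∑ u, Real.exp (-(κ / 2 * D x u)) ≤ S₁) (hS₂ : ∀ x, ∑ u, Real.exp (-(κ / 4 * D x u)) ≤ S₂)
    {Γ₁ Γ₂ : ℕ → Matrix n p ℂ} {K : ℕ → Matrix p p ℂ}
    (hΓ₁ : ∀ k x u, ‖Γ₁ k x u‖ ≤ γ₁ * Real.exp (-(κ * D x u))) (hΓ₂ : ∀ k x u, ‖Γ₂ k x u‖ ≤ γ₂ * Real.exp (-(κ * D x u)))
    (hΓ₁' : ∀ k x u, ‖(Γ₁ (k + 1) - Γ₁ k) x u‖ ≤ γ₁' * θ ^ k * Real.exp (-(κ * D x u)))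
    (hΓ₂' : ∀ k x u, ‖(Γ₂ (k + 1) - Γ₂ k) x u‖ ≤ γ₂' * θ ^ k * Real.exp (-(κ * D x u)))
    (hK : ∀ k, EntryDecay dp (K k) B κ) (hKr : TwoLevelDecayRate dp K B' κ θ) :
    TwoLevelDecayRate dist (fun k => Γ₁ k * K k * (Γ₂ k)ᴴ) ((γ₁' * B * γ₂ + γ₁ * B' * γ₂ + γ₁ * B * γ₂') * (S₁ * S₂)) (κ / 4) θ := by
  intro k
  have e : Γ₁ (k + 1) * K (k + 1) * (Γ₂ (k + 1))ᴴ - Γ₁ k * K k * (Γ₂ k)ᴴ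
      = (Γ₁ (k + 1) - Γ₁ k) * K (k + 1) * (Γ₂ (k + 1))ᴴ + Γ₁ k * (K (k + 1) - K k) * (Γ₂ (k + 1))ᴴ + Γ₁ k * K k * (Γ₂ (k + 1) - Γ₂ k)ᴴ := by
    rw [Matrix.conjTranspose_sub, Matrix.sub_mul, Matrix.sub_mul, Matrix.mul_sub, Matrix.sub_mul, Matrix.mul_sub]
    abel
  have h1 := entryDecay_vertexDress hDp hDD hdp0 hD0 hκ (mul_nonneg hγ₁' (pow_nonneg hθ k)) hγ₂ hB hS₁ hS₂ (hΓ₁' k) (hΓ₂ (k + 1)) (hK (k + 1))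
  have h2 := entryDecay_vertexDress hDp hDD hdp0 hD0 hκ hγ₁ hγ₂ (mul_nonneg hB' (pow_nonneg hθ k)) hS₁ hS₂ (hΓ₁ k) (hΓ₂ (k + 1)) (hKr k)
  have h3 := entryDecay_vertexDress hDp hDD hdp0 hD0 hκ hγ₁ (mul_nonneg hγ₂' (pow_nonneg hθ k)) hB hS₁ hS₂ (hΓ₁ k) (hΓ₂' k) (hK k)
  rw [e]
  intro x y
  rw [Matrix.add_apply, Matrix.add_apply]
  refine (norm_add₃_le).trans ?_
  refine (add_le_add_three (h1 x y) (h2 x y) (h3 x y)).trans (le_of_eq ?_)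
  ring

end Vertex

variable {d : ℕ} (L : ℕ) [NeZero L]

/-! ## §2 (UD)+(SR) of the one-loop contraction of an INPUT triple with moving legs -/

/-- **`decay_oneLoop_of_inputs_moving` — (UD)+(SR) OF `Γ_{1,k}(Y_k ⊗ₖ Y_k)Γ_{2,k}ᴴ` FOR ANY TOWER WITH THE TRIPLE's DECAY CLAUSES AND MOVING LEGS** (`d ≥ 2`, `κ > 0`, `B, B′, θ ≥ 0`):
`∃ C, C′ ≥ 0` (from `(d, κ, B, B′)`) such that on EVERY torus, for every tower `Y` with `EntryDecay distK (Y k) B κ` and `TwoLevelDecayRate distK Y B′ κ θ`, and all level-indexed legs with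
level envelope `γᵢe^{−κ(distK x q₁ + distK x q₂)}` and step envelope `γᵢ′θ^k e^{−κ(…)}`: `EntryDecay distK (Γ_{1,k}(Y_k ⊗ₖ Y_k)Γ_{2,k}ᴴ) (γ₁γ₂C) (κ∕4)` for all `k` and
`TwoLevelDecayRate distK (k ↦ Γ_{1,k}(Y_k ⊗ₖ Y_k)Γ_{2,k}ᴴ) ((γ₁′γ₂ + γ₁γ₂′)C + γ₁γ₂C′) (κ∕4) θ`. [folklore] -/
theorem decay_oneLoop_of_inputs_moving (hd : 2 ≤ d) {B B' κ θ : ℝ} (hκ : 0 < κ) (hB : 0 ≤ B) (hB' : 0 ≤ B') (hθ : 0 ≤ θ) :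
    ∃ C C' : ℝ, 0 ≤ C ∧ 0 ≤ C' ∧ ∀ (M : Fin d → ℕ) [∀ μ, NeZero (M μ)] (Y : ℕ → Matrix (idx L M 0) (idx L M 0) ℂ),
      (∀ k, EntryDecay (distK L M) (Y k) B κ) → TwoLevelDecayRate (distK L M) Y B' κ θ →
      ∀ (γ₁ γ₂ γ₁' γ₂' : ℝ), 0 ≤ γ₁ → 0 ≤ γ₂ → 0 ≤ γ₁' → 0 ≤ γ₂' → ∀ (Γ₁ Γ₂ : ℕ → Matrix (idx L M 0) (idx L M 0 × idx L M 0) ℂ),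
      (∀ k x q, ‖Γ₁ k x q‖ ≤ γ₁ * Real.exp (-(κ * (distK L M x q.1 + distK L M x q.2)))) →
      (∀ k x q, ‖Γ₂ k x q‖ ≤ γ₂ * Real.exp (-(κ * (distK L M x q.1 + distK L M x q.2)))) →
      (∀ k x q, ‖(Γ₁ (k + 1) - Γ₁ k) x q‖ ≤ γ₁' * θ ^ k * Real.exp (-(κ * (distK L M x q.1 + distK L M x q.2)))) →
      (∀ k x q, ‖(Γ₂ (k + 1) - Γ₂ k) x q‖ ≤ γ₂' * θ ^ k * Real.exp (-(κ * (distK L M x q.1 + distK L M x q.2)))) →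
      (∀ k, EntryDecay (distK L M) (Γ₁ k * (Y k ⊗ₖ Y k) * (Γ₂ k)ᴴ) (γ₁ * γ₂ * C) (κ / 4)) ∧
      TwoLevelDecayRate (distK L M) (fun k => Γ₁ k * (Y k ⊗ₖ Y k) * (Γ₂ k)ᴴ) (((γ₁' * γ₂ + γ₁ * γ₂') * C + γ₁ * γ₂ * C')) (κ / 4) θ := by
  obtain ⟨S₁, hS₁0, hS₁⟩ := sum_exp_pairDistK_le (d := d) hd (half_pos hκ)
  obtain ⟨S₂, hS₂0, hS₂⟩ := sum_exp_pairDistK_le (d := d) hd (by positivity : 0 < κ / 4)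
  refine ⟨B * B * ((d * S₁) * (d * S₁) * ((d * S₂) * (d * S₂))), (B' * B + B * B') * ((d * S₁) * (d * S₁) * ((d * S₂) * (d * S₂))), by positivity, by positivity,
    fun M _ Y hud hsr γ₁ γ₂ γ₁' γ₂' hγ₁ hγ₂ hγ₁' hγ₂' Γ₁ Γ₂ hΓ₁ hΓ₂ hΓ₁' hΓ₂' => ?_⟩
  obtain ⟨hDp, hDD, hD0⟩ := distK_legs_laws L M
  have hpair0 : ∀ q r : idx L M 0 × idx L M 0, 0 ≤ distK L M q.1 r.1 + distK L M q.2 r.2 := fun q r => add_nonneg (distK_nonneg L M _ _) (distK_nonneg L M _ _)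
  have hK : ∀ k, EntryDecay (fun q r : idx L M 0 × idx L M 0 => distK L M q.1 r.1 + distK L M q.2 r.2) (Y k ⊗ₖ Y k) (B * B) κ := fun k => entryDecay_kronecker (hud k) (hud k)
  have hKr := twoLevelDecayRate_kronecker hud hud hsr hsr
  refine ⟨fun k => ?_, ?_⟩
  · have := entryDecay_vertexDress (dist := distK L M) (D := fun x (q : idx L M 0 × idx L M 0) => distK L M x q.1 + distK L M x q.2) hDp hDD hpair0 hD0 hκ.le hγ₁ hγ₂
      (mul_nonneg hB hB) (fun x => hS₁ L M (x, x)) (fun x => hS₂ L M (x, x)) (hΓ₁ k) (hΓ₂ k) (hK k)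
    exact fun x y => (this x y).trans (le_of_eq (by ring))
  · have := twoLevelDecayRate_vertexDress_moving (dist := distK L M) (D := fun x (q : idx L M 0 × idx L M 0) => distK L M x q.1 + distK L M x q.2) hDp hDD hpair0 hD0 hκ.le
      hγ₁ hγ₂ hγ₁' hγ₂' (mul_nonneg hB hB) (by positivity : 0 ≤ B' * B + B * B') hθ (fun x => hS₁ L M (x, x)) (fun x => hS₂ L M (x, x)) hΓ₁ hΓ₂ hΓ₁' hΓ₂' hK hKr
    exact fun k x y => (this k x y).trans (le_of_eq (by ring))

/-! ## §3 The `ℤ^d` END of the one-loop contraction of an INPUT triple with moving legs -/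

/-- **`conv_oneLoop_of_inputs_moving` — THE ONE-LOOP CONTRACTION OF ANY INPUT TRIPLE WITH MOVING LEGS ON `ℤ^d`, MODULO ONLY THE LEGS** (`d ≥ 2`, cubic `side t → ∞`, `κ > 0`, `0 ≤ θ < 1`,
`μ ≠ ν`): for a volume-indexed tower `Y_t` with (UD) `(B, κ)`, (SR) `(B′, κ, θ)` and EL₂ at unit readings, `∃ C, C′ ≥ 0` such that for ALL `γᵢ, γᵢ′ ≥ 0` and ALL volume- and level-indexed
legs `Γ_{i,t,k}` with level envelope `γᵢ`, step envelope `γᵢ′θ^k` (rate `κ`) and EL₃ at every level: `∃ Π` with `IsInfiniteVolumeLimit side (Re (Γ_{1,t,k}(Y_{t,k} ⊗ₖ Y_{t,k})Γ_{2,t,k}ᴴ)(e(·,μ′),e(0,ν′))) (Π k)`,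
`UniformDecay Π μ ν (γ₁γ₂C) ((κ∕4)∕d)`, `StepRate Π μ ν ((γ₁′γ₂ + γ₁γ₂′)C + γ₁γ₂C′) ((κ∕4)∕d) θ`, `KernelInputs d Π`, second-moment convergence at ratio `θ`.
[cite: Balaban1987RG1, (1.21)–(1.22) p.264 (shapes)] [folklore] -/
theorem conv_oneLoop_of_inputs_moving (hd : 2 ≤ d) {side : ℕ → ℕ} [∀ t, NeZero (side t)] (hside : Tendsto side atTop atTop)
    {Y : (t : ℕ) → ℕ → Matrix (idx L (cubic d (side t)) 0) (idx L (cubic d (side t)) 0) ℂ} {B B' κ θ : ℝ}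
    (hκ : 0 < κ) (hB : 0 ≤ B) (hB' : 0 ≤ B') (hθ0 : 0 ≤ θ) (hθ1 : θ < 1)
    (hud : ∀ t k, EntryDecay (distK L (cubic d (side t))) (Y t k) B κ) (hsr : ∀ t, TwoLevelDecayRate (distK L (cubic d (side t))) (Y t) B' κ θ)
    (hel : ∀ k (μ ν : Fin d) (z z' : Fin d → ℤ), ∃ s' : ℂ, Tendsto (fun t => Y t k ((unitIdx L (cubic d (side t))).symm (castT (cubic d (side t)) z, μ))
      ((unitIdx L (cubic d (side t))).symm (castT (cubic d (side t)) z', ν))) atTop (𝓝 s'))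
    {μ ν : Fin d} (hne : μ ≠ ν) :
    ∃ C C' : ℝ, 0 ≤ C ∧ 0 ≤ C' ∧ ∀ (γ₁ γ₂ γ₁' γ₂' : ℝ), 0 ≤ γ₁ → 0 ≤ γ₂ → 0 ≤ γ₁' → 0 ≤ γ₂' →
      ∀ (Γ₁ Γ₂ : (t k : ℕ) → Matrix (idx L (cubic d (side t)) 0) (idx L (cubic d (side t)) 0 × idx L (cubic d (side t)) 0) ℂ),
      (∀ t k x q, ‖Γ₁ t k x q‖ ≤ γ₁ * Real.exp (-(κ * (distK L (cubic d (side t)) x q.1 + distK L (cubic d (side t)) x q.2)))) →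
      (∀ t k x q, ‖Γ₂ t k x q‖ ≤ γ₂ * Real.exp (-(κ * (distK L (cubic d (side t)) x q.1 + distK L (cubic d (side t)) x q.2)))) →
      (∀ t k x q, ‖(Γ₁ t (k + 1) - Γ₁ t k) x q‖ ≤ γ₁' * θ ^ k * Real.exp (-(κ * (distK L (cubic d (side t)) x q.1 + distK L (cubic d (side t)) x q.2)))) →
      (∀ t k x q, ‖(Γ₂ t (k + 1) - Γ₂ t k) x q‖ ≤ γ₂' * θ ^ k * Real.exp (-(κ * (distK L (cubic d (side t)) x q.1 + distK L (cubic d (side t)) x q.2)))) →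
      (∀ k (μ' l l' : Fin d) (z u v : Fin d → ℤ), ∃ s' : ℂ, Tendsto (fun t => Γ₁ t k ((unitIdx L (cubic d (side t))).symm (castT (cubic d (side t)) z, μ'))
        ((unitIdx L (cubic d (side t))).symm (castT (cubic d (side t)) u, l), (unitIdx L (cubic d (side t))).symm (castT (cubic d (side t)) v, l'))) atTop (𝓝 s')) →
      (∀ k (μ' l l' : Fin d) (z u v : Fin d → ℤ), ∃ s' : ℂ, Tendsto (fun t => Γ₂ t k ((unitIdx L (cubic d (side t))).symm (castT (cubic d (side t)) z, μ'))
        ((unitIdx L (cubic d (side t))).symm (castT (cubic d (side t)) u, l), (unitIdx L (cubic d (side t))).symm (castT (cubic d (side t)) v, l'))) atTop (𝓝 s')) →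
      ∃ Pinf : ℕ → B12Beta.Kernel d,
        (∀ k, IsInfiniteVolumeLimit side
          (fun t μ' ν' (z : Beta.Site d (side t)) => ((Γ₁ t k * (Y t k ⊗ₖ Y t k) * (Γ₂ t k)ᴴ) ((unitIdx L (cubic d (side t))).symm (z, μ')) ((unitIdx L (cubic d (side t))).symm (0, ν'))).re) (Pinf k)) ∧
        Beta.LimitRate.UniformDecay Pinf μ ν (γ₁ * γ₂ * C) ((κ / 4) / d) ∧ StepRate Pinf μ ν (((γ₁' * γ₂ + γ₁ * γ₂') * C + γ₁ * γ₂ * C')) ((κ / 4) / d) θ ∧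
        (∃ K : KernelInputs d Pinf, K.θ = θ ∧ K.c₀ = betaPrime510 d ((((γ₁' * γ₂ + γ₁ * γ₂') * C + γ₁ * γ₂ * C')) / (1 - θ)) ((κ / 4) / d) ∧ K.Pinf = limKernelOf Pinf ∧ K.μ = μ ∧ K.ν = ν) ∧
        (∀ k, |B12Beta.secondMoment (Pinf k) μ ν - B12Beta.secondMoment (limKernelOf Pinf) μ ν| ≤ betaPrime510 d ((((γ₁' * γ₂ + γ₁ * γ₂') * C + γ₁ * γ₂ * C')) / (1 - θ)) ((κ / 4) / d) * θ ^ k) := by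
  have hd1 : 1 ≤ d := le_trans (by norm_num) hd
  have hd0 : (0 : ℝ) < d := by exact_mod_cast lt_of_lt_of_le zero_lt_one hd1
  obtain ⟨C, C', hC, hC', hmov⟩ := decay_oneLoop_of_inputs_moving L hd hκ hB hB' hθ0
  refine ⟨C, C', hC, hC', fun γ₁ γ₂ γ₁' γ₂' hγ₁ hγ₂ hγ₁' hγ₂' Γ₁ Γ₂ hΓ₁ hΓ₂ hΓ₁' hΓ₂' hΓ₁el hΓ₂el => ?_⟩
  have hudL : ∀ t k, EntryDecay (distK L (cubic d (side t))) (Γ₁ t k * (Y t k ⊗ₖ Y t k) * (Γ₂ t k)ᴴ) (γ₁ * γ₂ * C) (κ / 4) :=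
    fun t => (hmov (cubic d (side t)) (Y t) (hud t) (hsr t) γ₁ γ₂ γ₁' γ₂' hγ₁ hγ₂ hγ₁' hγ₂' (Γ₁ t) (Γ₂ t) (hΓ₁ t) (hΓ₂ t) (hΓ₁' t) (hΓ₂' t)).1
  have hsrL : ∀ t, TwoLevelDecayRate (distK L (cubic d (side t))) (fun k => Γ₁ t k * (Y t k ⊗ₖ Y t k) * (Γ₂ t k)ᴴ) (((γ₁' * γ₂ + γ₁ * γ₂') * C + γ₁ * γ₂ * C')) (κ / 4) θ :=
    fun t => (hmov (cubic d (side t)) (Y t) (hud t) (hsr t) γ₁ γ₂ γ₁' γ₂' hγ₁ hγ₂ hγ₁' hγ₂' (Γ₁ t) (Γ₂ t) (hΓ₁ t) (hΓ₂ t) (hΓ₁' t) (hΓ₂' t)).2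
  -- the legs' window decay away from the root, rate `κ/d`, at one level
  have hwin : ∀ {γ : ℝ} (Γ : (t : ℕ) → Matrix (idx L (cubic d (side t)) 0) (idx L (cubic d (side t)) 0 × idx L (cubic d (side t)) 0) ℂ),
      (∀ t x q, ‖Γ t x q‖ ≤ γ * Real.exp (-(κ * (distK L (cubic d (side t)) x q.1 + distK L (cubic d (side t)) x q.2)))) → 0 ≤ γ →
      ∀ t (x : Beta.Site d (side t)) (μ' : Fin d) (u : Beta.Site d (side t)) (l : Fin d) (v : Beta.Site d (side t)) (l' : Fin d),
        ‖Γ t ((unitIdx L (cubic d (side t))).symm (x, μ')) ((unitIdx L (cubic d (side t))).symm (u, l), (unitIdx L (cubic d (side t))).symm (v, l'))‖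
          ≤ γ * (Real.exp (-(κ / d) * l1 (windowMap d (side t) (u - x))) * Real.exp (-(κ / d) * l1 (windowMap d (side t) (v - x)))) := by
    intro γ Γ hΓ hγ t x μ' u l v l'
    refine (hΓ t _ _).trans ?_
    rw [mul_add, neg_add, Real.exp_add]
    exact mul_le_mul_of_nonneg_left (mul_le_mul (exp_distK_le_exp_window_pair' L (side t) hκ.le x μ' u l)
      (exp_distK_le_exp_window_pair' L (side t) hκ.le x μ' v l') (Real.exp_pos _).le (Real.exp_pos _).le) hγ
  refine conv_of_decay_of_tendsto L hd1 hside (by positivity : 0 < κ / 4) hθ0 hθ1 hudL hsrL ?_ hne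
  intro k μ' ν' z
  have e0 : ∀ t, castT (cubic d (side t)) (0 : Fin d → ℤ) = 0 := fun t => by funext i; simp [castT]
  have hXb : ∀ t (i j : idx L (cubic d (side t)) 0), ‖Y t k i j‖ ≤ B := fun t i j => norm_le_of_entryDecay L (side t) hκ.le hB (hud t k) i j
  obtain ⟨s', hs'⟩ := tendsto_legs_pair L (side := side) hside hB hXb hXb (hwin (fun t => Γ₁ t k) (fun t => hΓ₁ t k) hγ₁) (hwin (fun t => Γ₂ t k) (fun t => hΓ₂ t k) hγ₂)
    (div_pos hκ hd0) (fun μ₁ ν₁ w w' => hel k μ₁ ν₁ w w') (fun μ₁ ν₁ w w' => hel k μ₁ ν₁ w w') (hΓ₁el k) (hΓ₂el k) μ' ν' z 0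
  refine ⟨s', hs'.congr fun t => ?_⟩
  rw [e0]

/-! ## §4 The one-loop contraction of the loop covariance `Y = c⁻¹𝒢c⁻¹` with moving legs -/

section LoopCov

variable (Lb : ℕ) [NeZero Lb] (a : ℝ) (ha : 0 < a) (s : ℕ → ℕ) [hs0 : ∀ t, NeZero (s t)]

/-- **`conv_oneLoop_loopCov_moving_of_rate` — CENSUS V196 (ζ) WITH ITS OWN LEG SHAPE: THE ONE-LOOP CONTRACTION `Γ_{1,k}(Y_k ⊗ₖ Y_k)Γ_{2,k}ᴴ` OF THE LOOP COVARIANCE `Y = c⁻¹𝒢c⁻¹` OF THE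
GAUGE-FIXED ONE-LOOP STEP ON `ℤ^{d+1}` WITH LEVEL-DEPENDENT LEGS, MODULO ONLY THE LEGS** (dimension `d + 1 ≥ 2`, `L ≥ 2`, every `Lb ≥ 1`, all `a, a′ > 0`, `μ ≠ ν`, every cubic coarse volume
sequence `s t → ∞`, `M_t = fine (Lb·1) (cubic (d+1) (s t))`; the legs' rate `κ_Γ > 0` PRESCRIBED, step ratio `√(L⁻¹)`): `∃ 0 < κ₁ ≤ κ_Γ`, `C, C′ ≥ 0` such that for all volume- and level-indexed
legs with level envelope `γᵢe^{−κ_Γ(distK x q₁ + distK x q₂)}`, step envelope `γᵢ′(√(L⁻¹))^k e^{−κ_Γ(…)}` and EL₃ at every level, the dressed contraction has limit kernels `Π` with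
`IsInfiniteVolumeLimit`, `UniformDecay Π μ ν (γ₁γ₂C) ((κ₁∕4)∕(d+1))`, `StepRate Π μ ν ((γ₁′γ₂ + γ₁γ₂′)C + γ₁γ₂C′) ((κ₁∕4)∕(d+1)) (√(L⁻¹))`, `KernelInputs`, second-moment convergence.
NO residual hypothesis beyond the legs. [cite: Balaban1987RG1, (1.20)–(1.22) p.264 (shapes)] [folklore] -/
theorem conv_oneLoop_loopCov_moving_of_rate (hL : 2 ≤ L) (hd : 1 ≤ d) (hs : Tendsto s atTop atTop) {a' : ℝ} (ha' : 0 < a') {μ ν : Fin (d + 1)} (hne : μ ≠ ν)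
    {κΓ : ℝ} (hκΓ : 0 < κΓ) :
    ∃ κ₁ C C' : ℝ, 0 < κ₁ ∧ κ₁ ≤ κΓ ∧ 0 ≤ C ∧ 0 ≤ C' ∧ ∀ (γ₁ γ₂ γ₁' γ₂' : ℝ), 0 ≤ γ₁ → 0 ≤ γ₂ → 0 ≤ γ₁' → 0 ≤ γ₂' →
      ∀ (Γ₁ Γ₂ : (t k : ℕ) → Matrix (idx L (fine (Lb * 1) (cubic (d + 1) (s t))) 0) (idx L (fine (Lb * 1) (cubic (d + 1) (s t))) 0 × idx L (fine (Lb * 1) (cubic (d + 1) (s t))) 0) ℂ),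
      (∀ t k x q, ‖Γ₁ t k x q‖ ≤ γ₁ * Real.exp (-(κΓ * (distK L (fine (Lb * 1) (cubic (d + 1) (s t))) x q.1 + distK L (fine (Lb * 1) (cubic (d + 1) (s t))) x q.2)))) →
      (∀ t k x q, ‖Γ₂ t k x q‖ ≤ γ₂ * Real.exp (-(κΓ * (distK L (fine (Lb * 1) (cubic (d + 1) (s t))) x q.1 + distK L (fine (Lb * 1) (cubic (d + 1) (s t))) x q.2)))) →
      (∀ t k x q, ‖(Γ₁ t (k + 1) - Γ₁ t k) x q‖ ≤ γ₁' * Real.sqrt ((L : ℝ)⁻¹) ^ k * Real.exp (-(κΓ * (distK L (fine (Lb * 1) (cubic (d + 1) (s t))) x q.1 + distK L (fine (Lb * 1) (cubic (d + 1) (s t))) x q.2)))) →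
      (∀ t k x q, ‖(Γ₂ t (k + 1) - Γ₂ t k) x q‖ ≤ γ₂' * Real.sqrt ((L : ℝ)⁻¹) ^ k * Real.exp (-(κΓ * (distK L (fine (Lb * 1) (cubic (d + 1) (s t))) x q.1 + distK L (fine (Lb * 1) (cubic (d + 1) (s t))) x q.2)))) →
      (∀ k (μ' l l' : Fin (d + 1)) (z u v : Fin (d + 1) → ℤ), ∃ s' : ℂ, Tendsto (fun t => Γ₁ t k ((unitIdx L (fine (Lb * 1) (cubic (d + 1) (s t)))).symm (castT (fine (Lb * 1) (cubic (d + 1) (s t))) z, μ')) (((unitIdx L (fine (Lb * 1) (cubic (d + 1) (s t)))).symm (castT (fine (Lb * 1) (cubic (d + 1) (s t))) u, l)), ((unitIdx L (fine (Lb * 1) (cubic (d + 1) (s t)))).symm (castT (fine (Lb * 1) (cubic (d + 1) (s t))) v, l')))) atTop (𝓝 s')) →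
      (∀ k (μ' l l' : Fin (d + 1)) (z u v : Fin (d + 1) → ℤ), ∃ s' : ℂ, Tendsto (fun t => Γ₂ t k ((unitIdx L (fine (Lb * 1) (cubic (d + 1) (s t)))).symm (castT (fine (Lb * 1) (cubic (d + 1) (s t))) z, μ')) (((unitIdx L (fine (Lb * 1) (cubic (d + 1) (s t)))).symm (castT (fine (Lb * 1) (cubic (d + 1) (s t))) u, l)), ((unitIdx L (fine (Lb * 1) (cubic (d + 1) (s t)))).symm (castT (fine (Lb * 1) (cubic (d + 1) (s t))) v, l')))) atTop (𝓝 s')) →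
      ∃ Pinf : ℕ → B12Beta.Kernel (d + 1),
        (∀ k, IsInfiniteVolumeLimit (fun t => Lb * 1 * s t)
          (fun t μ' ν' (z : Beta.Site (d + 1) (Lb * 1 * s t)) => ((Γ₁ t k * (((unitCovB L (fine (Lb * 1) (cubic (d + 1) (s t))) a ha k)⁻¹ * (((flucCov (reM (DelK (lev L k) (one_le_lev' L k) (fine (Lb * 1) (cubic (d + 1) (s t))) a ha)) (Matrix.fromRows (reM (QB 1 Lb (cubic (d + 1) (s t)))) (fun (t' : {x : Tor (fine (Lb * 1) (cubic (d + 1) (s t))) × Fin (d + 1) // (∀ ν, ν < x.2 → ((rem 1 Lb (cubic (d + 1) (s t)) x.1 ν : ℕ)) = 0) ∧ ((rem 1 Lb (cubic (d + 1) (s t)) x.1 x.2 : ℕ)) + 1 < Lb}) (x : Tor (fine (Lb * 1) (cubic (d + 1) (s t))) × Fin (d + 1)) => if x = (Function.Embedding.subtype (fun x : Tor (fine (Lb * 1) (cubic (d + 1) (s t))) × Fin (d + 1) => (∀ ν, ν < x.2 → ((rem 1 Lb (cubic (d + 1) (s t)) x.1 ν : ℕ)) = 0) ∧ ((rem 1 Lb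 (cubic (d + 1) (s t)) x.1 x.2 : ℕ)) + 1 < Lb)) t' then (1 : ℝ) else 0))).map ((↑) : ℝ → ℂ)).submatrix (unitIdx L (fine (Lb * 1) (cubic (d + 1) (s t)))) (unitIdx L (fine (Lb * 1) (cubic (d + 1) (s t))))) * (unitCovB L (fine (Lb * 1) (cubic (d + 1) (s t))) a ha k)⁻¹) ⊗ₖ ((unitCovB L (fine (Lb * 1) (cubic (d + 1) (s t))) a ha k)⁻¹ * (((flucCov (reM (DelK (lev L k) (one_le_lev' L k) (fine (Lb * 1) (cubic (d + 1) (s t))) a ha)) (Matrix.fromRows (reM (QB 1 Lb (cubic (d + 1) (s t)))) (fun (t' : {x : Tor (fine (Lb * 1) (cubic (d + 1) (s t))) × Fin (d + 1) // (∀ ν, ν < x.2 → ((rem 1 Lb (cubic (d + 1) (s t)) x.1 ν : ℕ)) = 0) ∧ ((rem 1 Lb (cubic (d + 1) (s t)) x.1 x.2 : ℕ)) + 1 < Lb}) (x : Tor (fine (Lb * 1) (cubic (d + 1) (s t))) × Fin (d + 1)) => if x = (Function.Embedding.subtype (fun x : Tor (fine (Lb * 1) (cubic (d + 1) (s t)))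 × Fin (d + 1) => (∀ ν, ν < x.2 → ((rem 1 Lb (cubic (d + 1) (s t)) x.1 ν : ℕ)) = 0) ∧ ((rem 1 Lb (cubic (d + 1) (s t)) x.1 x.2 : ℕ)) + 1 < Lb)) t' then (1 : ℝ) else 0))).map ((↑) : ℝ → ℂ)).submatrix (unitIdx L (fine (Lb * 1) (cubic (d + 1) (s t)))) (unitIdx L (fine (Lb * 1) (cubic (d + 1) (s t))))) * (unitCovB L (fine (Lb * 1) (cubic (d + 1) (s t))) a ha k)⁻¹)) * (Γ₂ t k)ᴴ) ((unitIdx L (fine (Lb * 1) (cubic (d + 1) (s t)))).symm (z, μ')) ((unitIdx L (fine (Lb * 1) (cubic (d + 1) (s t)))).symm (0, ν'))).re) (Pinf k)) ∧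
        Beta.LimitRate.UniformDecay Pinf μ ν (γ₁ * γ₂ * C) ((κ₁ / 4) / (((d + 1 : ℕ)) : ℝ)) ∧
        StepRate Pinf μ ν (((γ₁' * γ₂ + γ₁ * γ₂') * C + γ₁ * γ₂ * C')) ((κ₁ / 4) / (((d + 1 : ℕ)) : ℝ)) (Real.sqrt ((L : ℝ)⁻¹)) ∧
        (∃ K : KernelInputs (d + 1) Pinf, K.θ = Real.sqrt ((L : ℝ)⁻¹) ∧ K.c₀ = betaPrime510 (d + 1) ((((γ₁' * γ₂ + γ₁ * γ₂') * C + γ₁ * γ₂ * C')) / (1 - Real.sqrt ((L : ℝ)⁻¹))) ((κ₁ / 4) / (((d + 1 : ℕ)) : ℝ)) ∧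
          K.Pinf = limKernelOf Pinf ∧ K.μ = μ ∧ K.ν = ν) ∧
        (∀ k, |B12Beta.secondMoment (Pinf k) μ ν - B12Beta.secondMoment (limKernelOf Pinf) μ ν|
            ≤ betaPrime510 (d + 1) ((((γ₁' * γ₂ + γ₁ * γ₂') * C + γ₁ * γ₂ * C')) / (1 - Real.sqrt ((L : ℝ)⁻¹))) ((κ₁ / 4) / (((d + 1 : ℕ)) : ℝ)) * Real.sqrt ((L : ℝ)⁻¹) ^ k) := by
  have hd' : 2 ≤ d + 1 := by omega
  have hL1 : (1 : ℝ) < L := by exact_mod_cast (lt_of_lt_of_le one_lt_two hL : 1 < L)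
  have hθ0 : 0 ≤ Real.sqrt ((L : ℝ)⁻¹) := Real.sqrt_nonneg _
  have hθ1 : Real.sqrt ((L : ℝ)⁻¹) < 1 := by
    rw [show (1 : ℝ) = Real.sqrt 1 from Real.sqrt_one.symm]
    exact Real.sqrt_lt_sqrt (inv_nonneg.mpr (Nat.cast_nonneg _)) (inv_lt_one_of_one_lt₀ hL1)
  have hside : Tendsto (fun t => Lb * 1 * s t) atTop atTop :=
    Filter.tendsto_atTop_mono (fun t => Nat.le_mul_of_pos_left _ (Nat.pos_of_ne_zero (NeZero.ne (Lb * 1)))) hs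
  obtain ⟨κ₀, B, B', hκ₀, hB, hud, hsr, hel⟩ := exists_loopCov_inputs L a ha Lb s hL hd hs ha'
  have hB' : 0 ≤ B' := by
    haveI : Nonempty (idx L (fine (Lb * 1) (cubic (d + 1) (s 0))) 0) := ⟨(unitIdx L _).symm (0, μ)⟩
    exact twoLevelDecayRate_const_nonneg (hsr 0)
  have hκ₁ : 0 < min κ₀ κΓ := lt_min hκ₀ hκΓ
  have hud₁ : ∀ t k, EntryDecay (distK L (fine (Lb * 1) (cubic (d + 1) (s t)))) (((unitCovB L (fine (Lb * 1) (cubic (d + 1) (s t))) a ha k)⁻¹ * (((flucCov (reM (DelK (lev L k) (one_le_lev' L k) (fine (Lb * 1) (cubic (d + 1) (s t))) a ha)) (Matrix.fromRows (reM (QB 1 Lb (cubic (d + 1) (s t)))) (fun (t' : {x : Tor (fine (Lb * 1) (cubic (d + 1) (s t))) × Fin (d + 1) // (∀ ν, ν < x.2 → ((rem 1 Lb (cubic (d + 1) (s t)) x.1 ν : ℕ)) = 0) ∧ ((rem 1 Lb (cubic (d + 1) (s t)) x.1 x.2 : ℕ)) + 1 < Lb}) (x : Tor (fine (Lb * 1)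 (cubic (d + 1) (s t))) × Fin (d + 1)) => if x = (Function.Embedding.subtype (fun x : Tor (fine (Lb * 1) (cubic (d + 1) (s t))) × Fin (d + 1) => (∀ ν, ν < x.2 → ((rem 1 Lb (cubic (d + 1) (s t)) x.1 ν : ℕ)) = 0) ∧ ((rem 1 Lb (cubic (d + 1) (s t)) x.1 x.2 : ℕ)) + 1 < Lb)) t' then (1 : ℝ) else 0))).map ((↑) : ℝ → ℂ)).submatrix (unitIdx L (fine (Lb * 1) (cubic (d + 1) (s t)))) (unitIdx L (fine (Lb * 1) (cubic (d + 1) (s t))))) * (unitCovB L (fine (Lb * 1) (cubic (d + 1) (s t))) a ha k)⁻¹)) B (min κ₀ κΓ) :=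
    fun t k => entryDecay_of_le_rate (distK_nonneg L _) (hud t k) hB (min_le_left _ _)
  have hsr₁ : ∀ t, TwoLevelDecayRate (distK L (fine (Lb * 1) (cubic (d + 1) (s t)))) (fun k => ((unitCovB L (fine (Lb * 1) (cubic (d + 1) (s t))) a ha k)⁻¹ * (((flucCov (reM (DelK (lev L k) (one_le_lev' L k) (fine (Lb * 1) (cubic (d + 1) (s t))) a ha)) (Matrix.fromRows (reM (QB 1 Lb (cubic (d + 1) (s t)))) (fun (t' : {x : Tor (fine (Lb * 1) (cubic (d + 1) (s t))) × Fin (d + 1) // (∀ ν, ν < x.2 → ((rem 1 Lb (cubic (d + 1) (s t)) x.1 ν : ℕ)) = 0) ∧ ((rem 1 Lb (cubic (d + 1) (s t)) x.1 x.2 : ℕ)) + 1 < Lb}) (x : Tor (fine (Lb * 1) (cubic (d + 1) (s t))) × Fin (d + 1)) => if x = (Function.Embedding.subtype (fun x : Tor (fine (Lb * 1) (cubic (d + 1) (s t))) × Fin (d + 1) => (∀ ν, ν < x.2 → ((rem 1 Lb (cubic (d + 1) (s t)) x.1 ν : ℕ)) = 0) ∧ ((rem 1 Lb (cubic (d + 1)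 (s t)) x.1 x.2 : ℕ)) + 1 < Lb)) t' then (1 : ℝ) else 0))).map ((↑) : ℝ → ℂ)).submatrix (unitIdx L (fine (Lb * 1) (cubic (d + 1) (s t)))) (unitIdx L (fine (Lb * 1) (cubic (d + 1) (s t))))) * (unitCovB L (fine (Lb * 1) (cubic (d + 1) (s t))) a ha k)⁻¹)) B' (min κ₀ κΓ) (Real.sqrt ((L : ℝ)⁻¹)) :=
    fun t => twoLevelDecayRate_of_le_rate (distK_nonneg L _) (hsr t) hB' hθ0 (min_le_left _ _)
  -- an envelope at rate `κ_Γ` is one at rate `min κ₀ κ_Γ` (level and step envelopes alike: the prefactor is `≥ 0`)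
  have hweak : ∀ {c : ℝ} (G : (t : ℕ) → Matrix (idx L (fine (Lb * 1) (cubic (d + 1) (s t))) 0) (idx L (fine (Lb * 1) (cubic (d + 1) (s t))) 0 × idx L (fine (Lb * 1) (cubic (d + 1) (s t))) 0) ℂ), 0 ≤ c →
      (∀ t x q, ‖G t x q‖ ≤ c * Real.exp (-(κΓ * (distK L (fine (Lb * 1) (cubic (d + 1) (s t))) x q.1 + distK L (fine (Lb * 1) (cubic (d + 1) (s t))) x q.2)))) →
      ∀ t x q, ‖G t x q‖ ≤ c * Real.exp (-(min κ₀ κΓ * (distK L (fine (Lb * 1) (cubic (d + 1) (s t))) x q.1 + distK L (fine (Lb * 1) (cubic (d + 1) (s t))) x q.2))) := by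
    intro c G hc hG t x q
    refine (hG t x q).trans (mul_le_mul_of_nonneg_left (Real.exp_le_exp.mpr ?_) hc)
    have h0 : 0 ≤ distK L (fine (Lb * 1) (cubic (d + 1) (s t))) x q.1 + distK L (fine (Lb * 1) (cubic (d + 1) (s t))) x q.2 := add_nonneg (distK_nonneg L _ _ _) (distK_nonneg L _ _ _)
    nlinarith [min_le_right κ₀ κΓ]
  obtain ⟨C, C', hC, hC', h⟩ := conv_oneLoop_of_inputs_moving L hd' (side := fun t => Lb * 1 * s t) hside (Y := fun t k => ((unitCovB L (fine (Lb * 1) (cubic (d + 1) (s t))) a ha k)⁻¹ * (((flucCov (reM (DelK (lev L k) (one_le_lev' L k) (fine (Lb * 1) (cubic (d + 1) (s t))) a ha)) (Matrix.fromRows (reM (QB 1 Lb (cubic (d + 1) (s t)))) (fun (t' : {x : Tor (fine (Lb * 1) (cubic (d + 1) (s t))) × Fin (d + 1) // (∀ ν, ν < x.2 → ((rem 1 Lb (cubic (d + 1) (s t)) x.1 ν : ℕ)) = 0) ∧ ((rem 1 Lb (cubic (d + 1) (s t)) x.1 x.2 : ℕ)) + 1 < Lb}) (x : Tor (fine (Lb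 * 1) (cubic (d + 1) (s t))) × Fin (d + 1)) => if x = (Function.Embedding.subtype (fun x : Tor (fine (Lb * 1) (cubic (d + 1) (s t))) × Fin (d + 1) => (∀ ν, ν < x.2 → ((rem 1 Lb (cubic (d + 1) (s t)) x.1 ν : ℕ)) = 0) ∧ ((rem 1 Lb (cubic (d + 1) (s t)) x.1 x.2 : ℕ)) + 1 < Lb)) t' then (1 : ℝ) else 0))).map ((↑) : ℝ → ℂ)).submatrix (unitIdx L (fine (Lb * 1) (cubic (d + 1) (s t)))) (unitIdx L (fine (Lb * 1) (cubic (d + 1) (s t))))) * (unitCovB L (fine (Lb * 1) (cubic (d + 1) (s t))) a ha k)⁻¹)) hκ₁ hB hB' hθ0 hθ1 hud₁ hsr₁ hel hne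
  refine ⟨min κ₀ κΓ, C, C', hκ₁, min_le_right _ _, hC, hC', fun γ₁ γ₂ γ₁' γ₂' hγ₁ hγ₂ hγ₁' hγ₂' Γ₁ Γ₂ hΓ₁ hΓ₂ hΓ₁' hΓ₂' =>
    h γ₁ γ₂ γ₁' γ₂' hγ₁ hγ₂ hγ₁' hγ₂' Γ₁ Γ₂ (fun t k => hweak (fun t' => Γ₁ t' k) hγ₁ (fun t' => hΓ₁ t' k) t)
      (fun t k => hweak (fun t' => Γ₂ t' k) hγ₂ (fun t' => hΓ₂ t' k) t)
      (fun t k => hweak (fun t' => Γ₁ t' (k + 1) - Γ₁ t' k) (mul_nonneg hγ₁' (pow_nonneg hθ0 k)) (fun t' => hΓ₁' t' k) t)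
      (fun t k => hweak (fun t' => Γ₂ t' (k + 1) - Γ₂ t' k) (mul_nonneg hγ₂' (pow_nonneg hθ0 k)) (fun t' => hΓ₂' t' k) t)⟩

end LoopCov

end Summit.QuantumFields.BalabanUV.Beta.GAN24.OneStepLoopContractionMovingLegs

end
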